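import Summits.Ventures.CertifiedManyBodySolver.Observables.StiffnessApexTransportMottStation
import HarnessLib

/-!
# Ventures/CertifiedManyBodySolver — Observables/StiffnessApexTransportMottStationRects.lean

HONEST FRAMING: one-sided certified CEILINGS on the uniform flux stiffness (t–t′ f-sum class) at HALF FILLING (`n = 1`, Mott CONTROL/CALIBRATION line;
`ρ_s = 0` there in print is NOT a theorem here) on whole parameter BOXES `[U₁, U₂] × [t₁, t₂]`, from the «PH-SIGNED MOTT STATION» leaves of the companion
`Observables/StiffnessApexTransportMottStation.lean` (this seat, g5); conditional on the station's kinetic-ceiling nodes; a ceiling never speaks to the presence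
of order; not a `T_c` / superconductivity verdict; no number of record. Zero compute, no definition, no claim node, no `sorry`.

Cell `pub/hubbard-fast` (D-0154 (1)(A) «CERTIFICATE REUSE along parameter paths»), seat `hubbard-fast-reuse-2` g5 (`prover-hubbard-fast-reuse-2-g5-0`), path family
«APEX TRANSPORT», line «PH-SIGNED MOTT STATION», device «RECTANGLES».

THE POINT. The Mott-station leaf word at `(U, t′)` with station `(0, U₀)`, kinetic ceiling `X` and one free-gas floor `ℓ₂` at `κ₂` is
`[(2t′ − κ₂)·X/4 + (κ_A − 2t′)·(−ℓ₂/4)]/(κ_A − κ₂)` with `κ_A = −U₀t′/(U − U₀)`: a ratio whose numerator and denominator, after multiplying by `U − U₀ > 0`,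
are both AFFINE in `t′` and in `U` separately — so `word ≤ c` is the BILINEAR inequality `0 ≤ G(U, t′)`, and bilinear interpolation being exact on
`span{1, U, t′, Ut′}`, `G ≥ 0` at the four corners of a box gives `G ≥ 0` on the box. Four `norm_num` facts word a whole sub-cell (D-0042 R1b / R2(e):
«certify parameter BOXES instead of points»).

* `ObsStiffnessSeqCeilingAt_halfFilling_mottStation_leftRect` (`t′ ≤ 0` boxes, free member at `κ₂ < 2t₁`),
* `ObsStiffnessSeqCeilingAt_halfFilling_mottStation_rightRect` (`t′ ≥ 0` boxes, free member at `κ₂ > 2t₂`).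

References: T. Koma, H. Tasaki, J. Stat. Phys. 76 (1994) 745, §1 [KomaTasaki1994]; E. H. Lieb, F. Y. Wu, Physica A 321 (2003) 1, §1 eq. (3) [LiebWuPhysicaA2003];
E. H. Lieb, M. Loss, Duke Math. J. 71 (1993) 337, §8 Theorem 8.2 [LiebLoss1993]; D. J. Scalapino, S. R. White, S.-C. Zhang, PRB 47 (1993) 7995, §II [ScalapinoWhiteZhang1993].
-/

noncomputable section

namespace Summit.Ventures.CertifiedManyBodySolver.Observables

open Literature.MathematicalPhysics.QuantumLattice
open Literature.MathematicalPhysics.QuantumLattice.ThermodynamicLimit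
open Literature.MathematicalPhysics.QuantumFieldTheory
open Literature.Probability.LatticeModels
open Matrix Finset Filter Topology HubbardWave0
open scoped Matrix BigOperators ComplexOrder

/-! ## §1 Rectangles: the leaf inequality cleared of its denominators is BILINEAR in `(U, t′)` ⇒ four corner checks word a whole box -/

section Rects

variable {U₀ X : ℝ}

/-- **MOTT-STATION RECTANGLE, `t′ ≤ 0`.** Station `(0, U₀)` with kinetic ceiling `−k ≤ X`; a box `[U₁, U₂] × [t₁, t₂]` with `U₀ < U₁ < U₂`, `t₁ < t₂ ≤ 0`; ONE free-gas floor
`ℓ₂ ≤ e(1, κ₂, 0, 1)` at `κ₂ < 2t₁` for the whole box. The left-leaf inequality `μ_A·X/4 + μ₂·(−ℓ₂/4) ≤ c` multiplied by `(κ_A − κ₂)(U − U₀) > 0` reads `0 ≤ G(U, t′)` with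
`G(U,t′) = c(−U₀t′ − κ₂(U − U₀)) − (2t′ − κ₂)(U − U₀)·X/4 − (−U₀t′ − 2t′(U − U₀))·(−ℓ₂/4)`, BILINEAR in `(U, t′)`; bilinear interpolation is exact on bilinear functions,
so `G ≥ 0` at the four corners (four `norm_num` facts for the caller) gives `G ≥ 0` on the box and `ObsStiffnessSeqCeilingAt t′ U 1 c` at every point of it.
[cite: KomaTasaki1994, §1] [cite: LiebWuPhysicaA2003, §1 eq. (3)] [cite: LiebLoss1993, §8, Theorem 8.2] -/
theorem ObsStiffnessSeqCeilingAt_halfFilling_mottStation_leftRect (hU₀ : 0 ≤ U₀)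
    (hX : ∀ (ω : InfVolFermionState 2) (Ls : ℕ → ℕ) (ψ : ∀ L, Fock (Orb (FermionTorus 2 L))),
      Tendsto Ls atTop atTop →
      (∀ j, IsGroundStateInSector (hubbardTorusTT' (Ls j) 1 0 U₀) (rectN 1 (Ls j)) 0 (ψ (Ls j))) →
      (∀ j, star (ψ (Ls j)) ⬝ᵥ ψ (Ls j) = 1) → ω.IsTorusLimitOf ψ Ls →
      -(∑ i : Fin 2, -(1 : ℝ) * ∑ σ : Fin 2,
          ((ω.expect {0, 0 + unitVec i}
              ((cAt 0 (mem_insert_self _ _) σ)ᴴ * cAt (0 + unitVec i) (mem_insert_of_mem (mem_singleton_self _)) σ)).re +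
            (ω.expect {0, 0 + unitVec i}
              ((cAt (0 + unitVec i) (mem_insert_of_mem (mem_singleton_self _)) σ)ᴴ * cAt 0 (mem_insert_self _ _) σ)).re)) ≤ X)
    {U₁ U₂ t₁ t₂ κ₂ ℓ₂ : ℝ} (hU₁ : U₀ < U₁) (hU₁₂ : U₁ < U₂) (ht₁₂ : t₁ < t₂) (ht₂ : t₂ ≤ 0) (hκ₂ : κ₂ < 2 * t₁)
    (h₂ : ℓ₂ ≤ energyDensityTT' 1 κ₂ 0 1) (c : ℚ)
    (h11 : 0 ≤ ((c : ℚ) : ℝ) * (-U₀ * t₁ - κ₂ * (U₁ - U₀)) - (2 * t₁ - κ₂) * (U₁ - U₀) * (X / 4) - (-U₀ * t₁ - 2 * t₁ * (U₁ - U₀)) * (-ℓ₂ / 4))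
    (h12 : 0 ≤ ((c : ℚ) : ℝ) * (-U₀ * t₂ - κ₂ * (U₁ - U₀)) - (2 * t₂ - κ₂) * (U₁ - U₀) * (X / 4) - (-U₀ * t₂ - 2 * t₂ * (U₁ - U₀)) * (-ℓ₂ / 4))
    (h21 : 0 ≤ ((c : ℚ) : ℝ) * (-U₀ * t₁ - κ₂ * (U₂ - U₀)) - (2 * t₁ - κ₂) * (U₂ - U₀) * (X / 4) - (-U₀ * t₁ - 2 * t₁ * (U₂ - U₀)) * (-ℓ₂ / 4))
    (h22 : 0 ≤ ((c : ℚ) : ℝ) * (-U₀ * t₂ - κ₂ * (U₂ - U₀)) - (2 * t₂ - κ₂) * (U₂ - U₀) * (X / 4) - (-U₀ * t₂ - 2 * t₂ * (U₂ - U₀)) * (-ℓ₂ / 4))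
    {U t : ℝ} (hUl : U₁ ≤ U) (hUu : U ≤ U₂) (htl : t₁ ≤ t) (htu : t ≤ t₂) :
    ObsStiffnessSeqCeilingAt t U 1 c := by
  have hd : 0 < U - U₀ := by linarith
  refine ObsStiffnessSeqCeilingAt_halfFilling_mottStation_leftLeaf hU₀ hX (by linarith) (by linarith) (by linarith) h₂ c ?_
  set κA : ℝ := (U * 0 - U₀ * t) / (U - U₀) with hκA
  have hκA' : κA * (U - U₀) = -U₀ * t := by rw [hκA, div_mul_cancel₀ _ hd.ne']; ring
  have hR : 2 * t ≤ κA := by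
    rw [hκA, le_div_iff₀ hd]; nlinarith [mul_nonneg_of_nonpos_of_nonpos (by linarith : t ≤ 0) (by linarith : -(2 * U - U₀) ≤ 0)]
  have hD : 0 < κA - κ₂ := by linarith
  -- the bilinear form is nonnegative on the box (exact bilinear interpolation from the corners)
  have hG : 0 ≤ ((c : ℚ) : ℝ) * (-U₀ * t - κ₂ * (U - U₀)) - (2 * t - κ₂) * (U - U₀) * (X / 4) - (-U₀ * t - 2 * t * (U - U₀)) * (-ℓ₂ / 4) := by
    have key : (((c : ℚ) : ℝ) * (-U₀ * t - κ₂ * (U - U₀)) - (2 * t - κ₂) * (U - U₀) * (X / 4) - (-U₀ * t - 2 * t * (U - U₀)) * (-ℓ₂ / 4)) * ((U₂ - U₁) * (t₂ - t₁)) =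
        (((c : ℚ) : ℝ) * (-U₀ * t₁ - κ₂ * (U₁ - U₀)) - (2 * t₁ - κ₂) * (U₁ - U₀) * (X / 4) - (-U₀ * t₁ - 2 * t₁ * (U₁ - U₀)) * (-ℓ₂ / 4)) * ((U₂ - U) * (t₂ - t)) +
        (((c : ℚ) : ℝ) * (-U₀ * t₂ - κ₂ * (U₁ - U₀)) - (2 * t₂ - κ₂) * (U₁ - U₀) * (X / 4) - (-U₀ * t₂ - 2 * t₂ * (U₁ - U₀)) * (-ℓ₂ / 4)) * ((U₂ - U) * (t - t₁)) +
        (((c : ℚ) : ℝ) * (-U₀ * t₁ - κ₂ * (U₂ - U₀)) - (2 * t₁ - κ₂) * (U₂ - U₀) * (X / 4) - (-U₀ * t₁ - 2 * t₁ * (U₂ - U₀)) * (-ℓ₂ / 4)) * ((U - U₁) * (t₂ - t)) +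
        (((c : ℚ) : ℝ) * (-U₀ * t₂ - κ₂ * (U₂ - U₀)) - (2 * t₂ - κ₂) * (U₂ - U₀) * (X / 4) - (-U₀ * t₂ - 2 * t₂ * (U₂ - U₀)) * (-ℓ₂ / 4)) * ((U - U₁) * (t - t₁)) := by ring
    have hpos : 0 < (U₂ - U₁) * (t₂ - t₁) := mul_pos (by linarith) (by linarith)
    refine (mul_nonneg_iff_of_pos_right hpos).1 ?_
    rw [key]
    have a1 : 0 ≤ (U₂ - U) * (t₂ - t) := mul_nonneg (by linarith) (by linarith)
    have a2 : 0 ≤ (U₂ - U) * (t - t₁) := mul_nonneg (by linarith) (by linarith)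
    have a3 : 0 ≤ (U - U₁) * (t₂ - t) := mul_nonneg (by linarith) (by linarith)
    have a4 : 0 ≤ (U - U₁) * (t - t₁) := mul_nonneg (by linarith) (by linarith)
    have := mul_nonneg h11 a1; have := mul_nonneg h12 a2; have := mul_nonneg h21 a3; have := mul_nonneg h22 a4
    linarith
  -- clear the two denominators
  refine weighted_div_le_of_mul_le hD ?_
  have e : (((c : ℚ) : ℝ) * (κA - κ₂) - ((2 * t - κ₂) * (X / 4) + (κA - 2 * t) * (-ℓ₂ / 4))) * (U - U₀) =
      ((c : ℚ) : ℝ) * (-U₀ * t - κ₂ * (U - U₀)) - (2 * t - κ₂) * (U - U₀) * (X / 4) - (-U₀ * t - 2 * t * (U - U₀)) * (-ℓ₂ / 4) := by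
    linear_combination (((c : ℚ) : ℝ) + ℓ₂ / 4) * hκA'
  have h : 0 ≤ ((c : ℚ) : ℝ) * (κA - κ₂) - ((2 * t - κ₂) * (X / 4) + (κA - 2 * t) * (-ℓ₂ / 4)) :=
    (mul_nonneg_iff_of_pos_right hd).1 (by rw [e]; exact hG)
  linarith

/-- **MOTT-STATION RECTANGLE, `t′ ≥ 0`.** As above on a box `[U₁, U₂] × [t₁, t₂]` with `0 ≤ t₁ < t₂`, a free-gas floor at `κ₂ > 2t₂`, and the bilinear form
`G⁺(U,t′) = c(κ₂(U − U₀) + U₀t′) − (κ₂ − 2t′)(U − U₀)·X/4 − (2t′(U − U₀) + U₀t′)·(−ℓ₂/4)` checked at the four corners.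
[cite: KomaTasaki1994, §1] [cite: LiebWuPhysicaA2003, §1 eq. (3)] [cite: LiebLoss1993, §8, Theorem 8.2] -/
theorem ObsStiffnessSeqCeilingAt_halfFilling_mottStation_rightRect (hU₀ : 0 ≤ U₀)
    (hX : ∀ (ω : InfVolFermionState 2) (Ls : ℕ → ℕ) (ψ : ∀ L, Fock (Orb (FermionTorus 2 L))),
      Tendsto Ls atTop atTop →
      (∀ j, IsGroundStateInSector (hubbardTorusTT' (Ls j) 1 0 U₀) (rectN 1 (Ls j)) 0 (ψ (Ls j))) →
      (∀ j, star (ψ (Ls j)) ⬝ᵥ ψ (Ls j) = 1) → ω.IsTorusLimitOf ψ Ls →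
      -(∑ i : Fin 2, -(1 : ℝ) * ∑ σ : Fin 2,
          ((ω.expect {0, 0 + unitVec i}
              ((cAt 0 (mem_insert_self _ _) σ)ᴴ * cAt (0 + unitVec i) (mem_insert_of_mem (mem_singleton_self _)) σ)).re +
            (ω.expect {0, 0 + unitVec i}
              ((cAt (0 + unitVec i) (mem_insert_of_mem (mem_singleton_self _)) σ)ᴴ * cAt 0 (mem_insert_self _ _) σ)).re)) ≤ X)
    {U₁ U₂ t₁ t₂ κ₂ ℓ₂ : ℝ} (hU₁ : U₀ < U₁) (hU₁₂ : U₁ < U₂) (ht₁₂ : t₁ < t₂) (ht₁ : 0 ≤ t₁) (hκ₂ : 2 * t₂ < κ₂)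
    (h₂ : ℓ₂ ≤ energyDensityTT' 1 κ₂ 0 1) (c : ℚ)
    (h11 : 0 ≤ ((c : ℚ) : ℝ) * (κ₂ * (U₁ - U₀) + U₀ * t₁) - (κ₂ - 2 * t₁) * (U₁ - U₀) * (X / 4) - (2 * t₁ * (U₁ - U₀) + U₀ * t₁) * (-ℓ₂ / 4))
    (h12 : 0 ≤ ((c : ℚ) : ℝ) * (κ₂ * (U₁ - U₀) + U₀ * t₂) - (κ₂ - 2 * t₂) * (U₁ - U₀) * (X / 4) - (2 * t₂ * (U₁ - U₀) + U₀ * t₂) * (-ℓ₂ / 4))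
    (h21 : 0 ≤ ((c : ℚ) : ℝ) * (κ₂ * (U₂ - U₀) + U₀ * t₁) - (κ₂ - 2 * t₁) * (U₂ - U₀) * (X / 4) - (2 * t₁ * (U₂ - U₀) + U₀ * t₁) * (-ℓ₂ / 4))
    (h22 : 0 ≤ ((c : ℚ) : ℝ) * (κ₂ * (U₂ - U₀) + U₀ * t₂) - (κ₂ - 2 * t₂) * (U₂ - U₀) * (X / 4) - (2 * t₂ * (U₂ - U₀) + U₀ * t₂) * (-ℓ₂ / 4))
    {U t : ℝ} (hUl : U₁ ≤ U) (hUu : U ≤ U₂) (htl : t₁ ≤ t) (htu : t ≤ t₂) :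
    ObsStiffnessSeqCeilingAt t U 1 c := by
  have hd : 0 < U - U₀ := by linarith
  refine ObsStiffnessSeqCeilingAt_halfFilling_mottStation_rightLeaf hU₀ hX (by linarith) (by linarith) (by linarith) h₂ c ?_
  set κA : ℝ := (U * 0 - U₀ * t) / (U - U₀) with hκA
  have hκA' : κA * (U - U₀) = -U₀ * t := by rw [hκA, div_mul_cancel₀ _ hd.ne']; ring
  have hR : κA ≤ 2 * t := by
    rw [hκA, div_le_iff₀ hd]; nlinarith [mul_nonneg (by linarith : 0 ≤ t) (by linarith : 0 ≤ 2 * U - U₀)]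
  have hD : 0 < κ₂ - κA := by linarith
  have hG : 0 ≤ ((c : ℚ) : ℝ) * (κ₂ * (U - U₀) + U₀ * t) - (κ₂ - 2 * t) * (U - U₀) * (X / 4) - (2 * t * (U - U₀) + U₀ * t) * (-ℓ₂ / 4) := by
    have key : (((c : ℚ) : ℝ) * (κ₂ * (U - U₀) + U₀ * t) - (κ₂ - 2 * t) * (U - U₀) * (X / 4) - (2 * t * (U - U₀) + U₀ * t) * (-ℓ₂ / 4)) * ((U₂ - U₁) * (t₂ - t₁)) =
        (((c : ℚ) : ℝ) * (κ₂ * (U₁ - U₀) + U₀ * t₁) - (κ₂ - 2 * t₁) * (U₁ - U₀) * (X / 4) - (2 * t₁ * (U₁ - U₀) + U₀ * t₁) * (-ℓ₂ / 4)) * ((U₂ - U) * (t₂ - t)) +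
        (((c : ℚ) : ℝ) * (κ₂ * (U₁ - U₀) + U₀ * t₂) - (κ₂ - 2 * t₂) * (U₁ - U₀) * (X / 4) - (2 * t₂ * (U₁ - U₀) + U₀ * t₂) * (-ℓ₂ / 4)) * ((U₂ - U) * (t - t₁)) +
        (((c : ℚ) : ℝ) * (κ₂ * (U₂ - U₀) + U₀ * t₁) - (κ₂ - 2 * t₁) * (U₂ - U₀) * (X / 4) - (2 * t₁ * (U₂ - U₀) + U₀ * t₁) * (-ℓ₂ / 4)) * ((U - U₁) * (t₂ - t)) +
        (((c : ℚ) : ℝ) * (κ₂ * (U₂ - U₀) + U₀ * t₂) - (κ₂ - 2 * t₂) * (U₂ - U₀) * (X / 4) - (2 * t₂ * (U₂ - U₀) + U₀ * t₂) * (-ℓ₂ / 4)) * ((U - U₁) * (t - t₁)) := by ring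
    have hpos : 0 < (U₂ - U₁) * (t₂ - t₁) := mul_pos (by linarith) (by linarith)
    refine (mul_nonneg_iff_of_pos_right hpos).1 ?_
    rw [key]
    have a1 : 0 ≤ (U₂ - U) * (t₂ - t) := mul_nonneg (by linarith) (by linarith)
    have a2 : 0 ≤ (U₂ - U) * (t - t₁) := mul_nonneg (by linarith) (by linarith)
    have a3 : 0 ≤ (U - U₁) * (t₂ - t) := mul_nonneg (by linarith) (by linarith)
    have a4 : 0 ≤ (U - U₁) * (t - t₁) := mul_nonneg (by linarith) (by linarith)
    have := mul_nonneg h11 a1; have := mul_nonneg h12 a2; have := mul_nonneg h21 a3; have := mul_nonneg h22 a4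
    linarith
  refine weighted_div_le_of_mul_le hD ?_
  have e : (((c : ℚ) : ℝ) * (κ₂ - κA) - ((κ₂ - 2 * t) * (X / 4) + (2 * t - κA) * (-ℓ₂ / 4))) * (U - U₀) =
      ((c : ℚ) : ℝ) * (κ₂ * (U - U₀) + U₀ * t) - (κ₂ - 2 * t) * (U - U₀) * (X / 4) - (2 * t * (U - U₀) + U₀ * t) * (-ℓ₂ / 4) := by
    linear_combination (-(((c : ℚ) : ℝ)) - ℓ₂ / 4) * hκA'
  have h : 0 ≤ ((c : ℚ) : ℝ) * (κ₂ - κA) - ((κ₂ - 2 * t) * (X / 4) + (2 * t - κA) * (-ℓ₂ / 4)) :=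
    (mul_nonneg_iff_of_pos_right hd).1 (by rw [e]; exact hG)
  linarith

end Rects

end Summit.Ventures.CertifiedManyBodySolver.Observables

end
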